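import Mathlib
import Literature.Computability.Complexity.CircuitDAG
import Literature.Computability.Complexity.SymmetricDnf
import Summits.PneNP.PneNP.Theorems.SymmetryBudgetHamCompilesRankGadgetSymm
import Summits.PneNP.PneNP.Theorems.SymmetryBudgetHamCompilesIface

/-!
# Stub `stub_symmetricA` of the line `kotzig-cutspan` (crux `SymmetryBudget.HamCompiles`,
# stmt-PneNP-10637): the A-side interface has polynomial-size `Bud(m,g)`-symmetric circuits

For every `m` and every A-index `i : AIdx m` we build a labelled DAG `aDAG m i`
(`GateDAG`, `CircuitDAG.lean`) on the gate type `RΛ m ⊕ OΛ m` — the rank gadget of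
`SymmetryBudgetHamCompilesRankGadget.lean` plus output gates — whose compiled straight-line
program (`GateDAG.compile`) is over `acBasis ⊆ tcBasis`, has `≤ 14 (m+1)^3` gates, computes
`x ↦ aData m x i` (`aDAG_evalOut`) and is `Bud m (gOf m)`-symmetric
(`GateDAG.isSymmetricUnder_compile_iff`, `aDAG_isSymm`: `ρ ∈ Bud` acts on gate labels by
relabelling vertex indices, pattern `SymmetricDnf.dnfDAG_isAut`). Output gates:
`inl (a,a')` ↦ `[a, a' anchored] ∧ x(a,a')`;
`inr (i,a)` ↦ `⋁_u ([u free] ∧ [rk u = i] ∧ [a ∈ cls u])` (for `a` free the output is the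
constant `false`, a `Bud`-fixed gate).

Main result: `stub_symmetricA` with `q = 14 (X + 1)^3`.
-/

-- `Summit.PneNP.PneNP.…` duplicates `PneNP` BY DESIGN (single-problem summit, D-0017).
set_option linter.dupNamespace false

noncomputable section

namespace Summit.PneNP.PneNP.Theorems.HamCompilesKC

open Literature.Computability.Complexity
open Finset

namespace SymA

variable {m : ℕ}

/-! ### The DAG: rank gadget plus output gates -/

/-- Output gate labels. -/
inductive OΛ (m : ℕ) : Type
  /-- the constant `false` (output for non-anchored indices) -/
  | zero : OΛ m
  /-- `[u free] ∧ [rk u = i] ∧ [a ∈ cls u]` -/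
  | term (i : Fin (gOf m)) (u a : Fin m) : OΛ m
  /-- `⋁_u term i u a` = `aData (inr (i, a))` -/
  | outG (i : Fin (gOf m)) (a : Fin m) : OΛ m
  /-- the constant `[a anchored ∧ a' anchored]` -/
  | aa (a a' : Fin m) : OΛ m
  /-- `aa a a' ∧ x(a,a')` = `aData (inl (a, a'))` -/
  | inlG (a a' : Fin m) : OΛ m

/-- The output gate labels form a finite type (via the proxy sum-of-products type). -/
instance instFintypeOΛ (m : ℕ) : Fintype (OΛ m) := Fintype.ofEquiv _ (proxy_equiv% (OΛ m))

/-- All gate labels. -/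
abbrev AΛ (m : ℕ) : Type := RΛ m ⊕ OΛ m

/-- All wires. -/
abbrev AWire (m : ℕ) : Type := (Fin m × Fin m) ⊕ AΛ m

/-- Gate functions of the output gates. -/
def ofn : OΛ m → GateFn
  | .zero => GateFn.or 0
  | .term _ _ _ => GateFn.and 3
  | .outG _ _ => GateFn.or m
  | .aa a a' => GateFn.const (decide (IsAnch m a ∧ IsAnch m a'))
  | .inlG _ _ => GateFn.and 2

/-- Wires of the output gates. -/
def oargs : (o : OΛ m) → Fin (ofn o).1 → AWire m
  | .zero => Fin.elim0
  | .term i u a => ![Sum.inr (Sum.inl (.free u)), Sum.inr (Sum.inl (.eqrank i u)),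
      Sum.inr (Sum.inl (.adj u a))]
  | .outG i a => fun u => Sum.inr (Sum.inr (.term i u a))
  | .aa _ _ => Fin.elim0
  | .inlG a a' => ![Sum.inr (Sum.inr (.aa a a')), Sum.inl (a, a')]

/-- Gate functions of the whole DAG. -/
def afn : AΛ m → GateFn
  | .inl l => rfn l
  | .inr o => ofn o

/-- Wires of the whole DAG (the gadget's wires embedded along `inl`). -/
def aargs : (l : AΛ m) → Fin (afn l).1 → AWire m
  | .inl l => fun a => (rargs l a).map id Sum.inl
  | .inr o => oargs o

/-- Layers of the whole DAG. -/
def alayer : AΛ m → ℕ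
  | .inl l => rlayer l
  | .inr .zero => 0
  | .inr (.term _ _ _) => 2 * gOf m + 13
  | .inr (.outG _ _) => 2 * gOf m + 14
  | .inr (.aa _ _) => 0
  | .inr (.inlG _ _) => 1

/-- Wires go down. -/
theorem alayer_lt_of_aargs {l l' : AΛ m} {a : Fin (afn l).1} (h : aargs l a = Sum.inr l') :
    alayer l' < alayer l := by
  cases l with
  | inl l =>
    change (rargs l a).map id Sum.inl = Sum.inr l' at h
    cases hq : rargs l a with
    | inl q => rw [hq] at h; exact absurd h Sum.inl_ne_inr
    | inr l'' =>
      rw [hq] at h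
      cases h
      exact rlayer_lt_of_rargs hq
  | inr o =>
    cases o with
    | zero => exact a.elim0
    | term i u b =>
      revert h
      refine Fin.cases ?_ (Fin.cases ?_ (Fin.cases ?_ (fun j => j.elim0))) a <;>
        simp [aargs, oargs] <;> rintro rfl <;> simp only [alayer, rlayer] <;> omega
    | outG i b =>
      simp only [aargs, oargs] at h
      cases h; simp only [alayer]; omega
    | aa => exact a.elim0
    | inlG b b' =>
      revert h
      refine Fin.cases ?_ (Fin.cases ?_ (fun j => j.elim0)) a <;> simp [aargs, oargs]
      rintro rfl; simp only [alayer]; omega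

/-- The output wire of index `i` (a `Bud`-fixed gate: the constant `false` unless the vertex
indices of `i` are anchored). -/
def aout (m : ℕ) : AIdx m → AWire m
  | .inl (a, a') =>
      if IsAnch m a ∧ IsAnch m a' then Sum.inr (Sum.inr (.inlG a a')) else Sum.inr (Sum.inr .zero)
  | .inr (i, a) => if IsAnch m a then Sum.inr (Sum.inr (.outG i a)) else Sum.inr (Sum.inr .zero)

/-- **The DAG computing `aData m · i`.** -/
def aDAG (m : ℕ) (i : AIdx m) : GateDAG (Fin m × Fin m) (AΛ m) where
  fn := afn
  args := aargs
  out := aout m i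
  wf := Subrelation.wf (fun ⟨_, h⟩ => alayer_lt_of_aargs h) (InvImage.wf alayer wellFounded_lt)

/-- Gate functions of `aDAG`. -/
@[simp] theorem aDAG_fn (i : AIdx m) (l : AΛ m) : (aDAG m i).fn l = afn l := rfl

/-- Wires of `aDAG`. -/
@[simp] theorem aDAG_args (i : AIdx m) (l : AΛ m) : (aDAG m i).args l = aargs l := rfl

/-- All gate functions are in `tcBasis` (indeed in `acBasis`). -/
theorem afn_mem_tcBasis (l : AΛ m) : afn l ∈ tcBasis := by
  refine acBasis_subset_tcBasis ?_
  rcases l with l | (_ | _ | _ | _ | _)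
  · exact rfn_mem_acBasis l
  · exact or_mem_acBasis _
  · exact and_mem_acBasis _
  · exact or_mem_acBasis _
  · exact const_mem_acBasis _
  · exact and_mem_acBasis _

/-! ### Semantics -/

section Sem

variable (i : AIdx m) (x : Fin m × Fin m → Bool)

/-- The gadget gates of `aDAG` take the gadget's values. -/
theorem aDAG_val_inl (l : RΛ m) : (aDAG m i).val x (Sum.inl l) = rsem m x l := by
  have key := eq_rsem x (w := fun l => (aDAG m i).val x (Sum.inl l)) (fun l => by
    rw [GateDAG.val_eq]
    refine congrArg (rfn l).2 (funext fun a => ?_)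
    show GateDAG.wire x ((aDAG m i).val x) ((rargs l a).map id Sum.inl) = _
    cases rargs l a <;> rfl)
  exact congrFun key l

/-- Value of a `term` gate. -/
theorem aDAG_val_term (j : Fin (gOf m)) (u a : Fin m) :
    (aDAG m i).val x (Sum.inr (.term j u a)) =
      decide (¬ IsAnch m u ∧ rk m x u = (j : ℕ) ∧ a ∈ cls m x u) := by
  rw [GateDAG.val_eq]
  simp only [aDAG_fn, aDAG_args, afn, ofn, aargs, oargs, GateFn.and, Fin.forall_fin_succ,
    IsEmpty.forall_iff, and_true, Matrix.cons_val_zero, Matrix.cons_val_succ, GateDAG.wire_inr,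
    aDAG_val_inl, rsem]
  rw [Bool.eq_iff_iff]
  simp only [decide_eq_true_eq]

/-- Value of an `outG` gate: `aData (inr (j, a))`. -/
theorem aDAG_val_outG (j : Fin (gOf m)) (a : Fin m) :
    (aDAG m i).val x (Sum.inr (.outG j a)) =
      decide (∃ u ∈ freeSet m, rk m x u = (j : ℕ) ∧ a ∈ cls m x u) := by
  rw [GateDAG.val_eq]
  simp only [aDAG_fn, aDAG_args, afn, ofn, aargs, oargs, GateFn.or, GateDAG.wire_inr,
    aDAG_val_term]
  rw [Bool.eq_iff_iff]
  simp only [decide_eq_true_eq, mem_freeSet_iff]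

/-- Value of an `inlG` gate: `aData (inl (a, a'))`. -/
theorem aDAG_val_inlG (a a' : Fin m) :
    (aDAG m i).val x (Sum.inr (.inlG a a')) =
      decide (IsAnch m a ∧ IsAnch m a' ∧ x (a, a') = true) := by
  rw [GateDAG.val_eq]
  simp only [aDAG_fn, aDAG_args, afn, ofn, aargs, oargs, GateFn.and, Fin.forall_fin_two,
    Matrix.cons_val_zero, Matrix.cons_val_one, GateDAG.wire_inr, GateDAG.wire_inl]
  rw [GateDAG.val_eq]
  simp only [aDAG_fn, afn, ofn, GateFn.const]
  rw [Bool.eq_iff_iff]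
  simp only [decide_eq_true_eq, and_assoc]

/-- Value of the `zero` gate. -/
theorem aDAG_val_zero : (aDAG m i).val x (Sum.inr .zero) = false := by
  rw [GateDAG.val_eq]
  simp [aDAG_fn, afn, ofn, GateFn.or]

/-- **`aDAG m i` computes `aData m · i`.** -/
theorem aDAG_evalOut : (aDAG m i).evalOut x = aData m x i := by
  show GateDAG.wire x ((aDAG m i).val x) (aout m i) = aData m x i
  rcases i with ⟨a, a'⟩ | ⟨j, a⟩
  · simp only [aout, aData]
    split_ifs with h
    · rw [GateDAG.wire_inr, aDAG_val_inlG, Bool.eq_iff_iff]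
    · rw [GateDAG.wire_inr, aDAG_val_zero, eq_comm, decide_eq_false_iff_not]
      exact fun h' => h ⟨h'.1, h'.2.1⟩
  · simp only [aout, aData]
    split_ifs with h
    · rw [GateDAG.wire_inr, aDAG_val_outG, Bool.eq_iff_iff]
    · rw [GateDAG.wire_inr, aDAG_val_zero, eq_comm, decide_eq_false_iff_not]
      rintro ⟨u, -, -, hu⟩
      exact h (isAnch_of_mem_cls hu)

end Sem

/-! ### Symmetry -/

/-- Relabelling the vertex indices of an output gate label. -/
def omap (f : Fin m → Fin m) : OΛ m → OΛ m
  | .zero => .zero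
  | .term i u a => .term i (f u) (f a)
  | .outG i a => .outG i (f a)
  | .aa a a' => .aa (f a) (f a')
  | .inlG a a' => .inlG (f a) (f a')

/-- `omap` is functorial. -/
theorem omap_omap (f f' : Fin m → Fin m) (o : OΛ m) :
    omap f (omap f' o) = omap (f ∘ f') o := by
  cases o <;> rfl

/-- `omap` of the identity. -/
theorem omap_id (o : OΛ m) : omap id o = o := by
  cases o <;> rfl

/-- The bijection of output gate labels induced by a vertex permutation. -/
def oθ (ρ : Equiv.Perm (Fin m)) : OΛ m ≃ OΛ m where
  toFun := omap ρ
  invFun := omap ρ.symm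
  left_inv o := by rw [omap_omap, ρ.symm_comp_self, omap_id]
  right_inv o := by rw [omap_omap, ρ.self_comp_symm, omap_id]

/-- The bijection of all gate labels induced by a vertex permutation. -/
def aθ (ρ : Equiv.Perm (Fin m)) : AΛ m ≃ AΛ m := Equiv.sumCongr (rθ ρ) (oθ ρ)

/-- **`aθ ρ` is an automorphism of `aDAG m i` over `ρ × ρ`**, for `ρ` in the budget. -/
theorem aDAG_isAut {ρ : Equiv.Perm (Fin m)} (hρ : ρ ∈ Bud m (gOf m)) (i : AIdx m) :
    (aDAG m i).IsAut (diag ρ) (aθ ρ) := by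
  refine ⟨?_, ?_, ?_⟩
  · show Sum.map (diag ρ) (aθ ρ) (aout m i) = aout m i
    rcases i with ⟨a, a'⟩ | ⟨j, a⟩
    · simp only [aout]
      split_ifs with h
      · show Sum.inr (Sum.inr (OΛ.inlG (ρ a) (ρ a'))) = _
        rw [bud_apply hρ h.1, bud_apply hρ h.2]
      · rfl
    · simp only [aout]
      split_ifs with h
      · show Sum.inr (Sum.inr (OΛ.outG j (ρ a))) = _
        rw [bud_apply hρ h]
      · rfl
  · rintro (l | o)
    · exact rfn_rθ hρ l
    · cases o with
      | aa a a' =>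
        show GateFn.const _ = GateFn.const _
        simp only [isAnch_bud_iff hρ]
      | _ => rfl
  · rintro (l | o)
    · exact map_rargs_rθ hρ Sum.inl (aθ ρ) (fun _ => rfl) l
    · rw [List.map_ofFn]
      cases o with
      | zero => exact perm_ofFn_of_eq fun j => j.elim0
      | term j u a => exact perm_ofFn_of_eq fun t => by fin_cases t <;> rfl
      | outG j a =>
        let G : Fin m → AWire m := fun u => Sum.inr (Sum.inr (.term j u (ρ a)))
        have h1 : List.ofFn ((aDAG m i).args (aθ ρ (Sum.inr (.outG j a)))) = List.ofFn G := rfl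
        have h2 : List.ofFn (Sum.map (diag ρ) (aθ ρ) ∘ (aDAG m i).args (Sum.inr (.outG j a))) =
            List.ofFn (G ∘ ρ) := rfl
        rw [h1, h2]
        exact (Equiv.Perm.ofFn_comp_perm ρ G).symm
      | aa a a' => exact perm_ofFn_of_eq fun j => j.elim0
      | inlG a a' => exact perm_ofFn_of_eq fun t => by fin_cases t <;> rfl

/-- **`aDAG m i` is symmetric under the budget** (as a DAG). -/
theorem aDAG_isSymm (i : AIdx m) : (aDAG m i).IsSymm (GateDAG.diagMaps (Bud m (gOf m))) := by
  rintro π ⟨ρ, hρ, rfl⟩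
  exact ⟨aθ ρ, aDAG_isAut hρ i⟩

/-! ### Size and the stub -/

/-- The number of output gates. -/
theorem card_OΛ (m : ℕ) :
    Fintype.card (OΛ m) = 1 + gOf m * (m * m) + gOf m * m + m * m + m * m := by
  rw [← Fintype.card_congr (OΛ.proxyTypeEquiv m)]
  simp [Fintype.card_sum]
  ring

/-- **Size bound**: at most `14 (m + 1)^3` gates. -/
theorem card_AΛ_le (m : ℕ) : Fintype.card (AΛ m) ≤ 14 * (m + 1) ^ 3 := by
  rw [Fintype.card_sum, card_OΛ]
  have hg := gOf_le m
  have hR := card_RΛ_le m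
  have hO : 1 + gOf m * (m * m) + gOf m * m + m * m + m * m ≤ 3 * (m + 1) ^ 3 :=
    calc 1 + gOf m * (m * m) + gOf m * m + m * m + m * m
        ≤ 1 + m * (m * m) + m * m + m * m + m * m := by gcongr
      _ ≤ 1 + m * (m * m) + m * m + m * m + m * m + (2 * (m * m * m) + 6 * (m * m) + 9 * m + 2) :=
          Nat.le_add_right _ _
      _ = 3 * (m + 1) ^ 3 := by ring
  omega

end SymA

open SymA in
/-- **stub_symmetricA.** Every A-side interface bit `x ↦ aData m x i` has a
`Bud(m, g(m))`-symmetric threshold circuit of size `≤ 14 (m + 1)^3`: the compiled DAG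
`aDAG m i` (rank gadget + output gates), over `acBasis ⊆ tcBasis`, symmetric because every
`ρ ∈ Bud` relabels its gates
(`aDAG_isSymm`, `GateDAG.isSymmetricUnder_compile_iff`), correct by `aDAG_evalOut`. -/
theorem stub_symmetricA : ∃ q : Polynomial ℕ, ∀ m : ℕ, 4 ≤ m → ∀ i : AIdx m,
    HasSymCircuit tcBasis (Bud m (gOf m)) (q.eval m) (fun x => aData m x i) := by
  refine ⟨Polynomial.C 14 * (Polynomial.X + 1) ^ 3, fun m _ i => ?_⟩
  have heval : (Polynomial.C 14 * (Polynomial.X + 1) ^ 3 : Polynomial ℕ).eval m =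
      14 * (m + 1) ^ 3 := by
    simp
  rw [heval]
  refine ⟨(aDAG m i).compile, GateDAG.compile_isOver _ afn_mem_tcBasis, ?_,
    (GateDAG.isSymmetricUnder_compile_iff _ _).2 (aDAG_isSymm i), fun x => ?_⟩
  · rw [Circuit.size, GateDAG.compile_gates_length]
    exact card_AΛ_le m
  · rw [GateDAG.compile_eval, aDAG_evalOut]

end Summit.PneNP.PneNP.Theorems.HamCompilesKC
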